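import Summits.CriticalPhenomena.PercolationContinuityZ3.Theorems.Transplant.PlanarDirConeCritical
import Summits.CriticalPhenomena.PercolationContinuityZ3.Theorems.Transplant.WeightedConeExits
import HarnessLib

/-!
# WEIGHTED CONES of `ℤ³` around a COORDINATE-PLANE direction — III: the climb on the positive coordinates and its slack, coordinate bounds,
# exits of the height cut sets, the escape-and-climb datum (first file of the uniqueness column for `v = (v₀, v₁, 0)`)

builds on p205010 (kernel theorem, internal audit signed; external expert review pending) — NOT used in this file.
Lane `prim-bschramm`, seat `prim-bschramm-p2` (gen 30; class C1b, METHOD = input substitution; memo `HOME/bschramm/P2-LATTICES.md` §107);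
helper file (`--supports stmt-CriticalPhenomena-4575 --as helper`) for ROW N6 of TABLE v44 (directions with exactly one vanishing coordinate).
The analogue of `WeightedConeExits` when `v₂ = 0`: the CLIMB steps only the POSITIVE-weight coordinates `0, 1` (`PlanarDirConeGeometry.step_mem₀`,
argmin ratio among them): the height grows by `≥ κ` per step, the pair terms with the zero-weight coordinate (`±vⱼx₂`) are UNCHANGED, so after
`m` steps every pair inequality has slack `mτκ` (`pclimb_slack`, no side condition); the cut sets are the height cut sets `WCone.cut` of
`WeightedConeExits`; an exit has a cone neighbour `u + eⱼ` (`j ∈ {0,1}` automatically) above the level (`exit_of_cut₀`); `escape_pclimb_datum`.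
[cite: AizenmanChayesChayesFrohlichRusso1983, §4 (4.26), Lemma 4.2 (a)] [cite: GrimmettPercolation1999, §7.2 p. 148; §11.5 notes p. 347] -/

noncomputable section

namespace Summit.CriticalPhenomena.PercolationContinuityZ3.Theorems.Transplant

namespace PWCone

open MeasureTheory Literature.Probability.Percolation Literature.Probability.LatticeModels SimpleGraph HSU OrthantUniq HalfSlabUniq
  TubeSlabUniq DesignTransport WallUniq DiagCone WCone Filter
open scoped Classical

/-! ## §1 The positive argmin coordinate, the climb, the slack -/

/-- A positive argmin-ratio coordinate of `x` (some `i ≠ 2` with `D_{ij}(x) ≤ 0` for all `j ≠ 2`, if one exists; else `0`). [folklore] -/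
def plowIdx (v : Fin 3 → ℝ) (x : Site 3) : Fin 3 :=
  if hex : ∃ i : Fin 3, i ≠ 2 ∧ ∀ j : Fin 3, j ≠ 2 → dev v x i j ≤ 0 then Classical.choose hex else 0

/-- **The positive climb**: `n` positive argmin-ratio steps. [folklore] -/
def pclimb (v : Fin 3 → ℝ) : ℕ → Site 3 → Site 3
  | 0, x => x
  | n + 1, x => pclimb v n x + Pi.single (plowIdx v (pclimb v n x)) 1

/-- `pclimb 0 x = x`. [folklore] -/
@[simp] theorem pclimb_zero (v : Fin 3 → ℝ) (x : Site 3) : pclimb v 0 x = x := rfl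

/-- The successor step of the positive climb. [folklore] -/
theorem pclimb_succ (v : Fin 3 → ℝ) (n : ℕ) (x : Site 3) :
    pclimb v (n + 1) x = pclimb v n x + Pi.single (plowIdx v (pclimb v n x)) 1 := rfl

/-- Consecutive climb points are lattice neighbours. [folklore] -/
theorem pclimb_adj (v : Fin 3 → ℝ) (n : ℕ) (x : Site 3) : (zdGraph 3).Adj (pclimb v n x) (pclimb v (n + 1) x) := by
  rw [pclimb_succ, zdGraph_adj_iff]; exact ⟨_, Or.inl rfl⟩

section Cone

variable {v : Fin 3 → ℝ} {κ K τ h : ℝ} (hv2 : v 2 = 0) (hκ : 0 < κ) (hv0 : κ ≤ v 0) (hv1 : κ ≤ v 1) (hvK : ∀ i, v i ≤ K) (hτ : 0 < τ)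
  (hh : K ≤ τ * h) {D : Set (Site 3)} (hCD : ∀ x : Site 3, x ∈ D ↔ h ≤ hgt v x ∧ ∀ i j : Fin 3, dev v x i j ≤ τ * hgt v x)

include hv2 hκ hv0 hv1 in
/-- `plowIdx x ≠ 2` and it is an argmin among the positive coordinates: `D_{plowIdx x, j}(x) ≤ 0` for all `j ≠ 2`. [folklore] -/
theorem plowIdx_low (x : Site 3) : plowIdx v x ≠ 2 ∧ ∀ j : Fin 3, j ≠ 2 → dev v x (plowIdx v x) j ≤ 0 := by
  have hex := exists_plow hv2 hκ hv0 hv1 x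
  unfold plowIdx
  rw [dif_pos hex]
  exact Classical.choose_spec hex

include hv2 hκ hv0 hv1 hvK in
/-- **Coordinates and height of the positive climb**: coordinates in `[xⱼ, xⱼ + n]`, `x₂` unchanged, `H(x) + nκ ≤ H ≤ H(x) + nK`. [folklore] -/
theorem pclimb_props (x : Site 3) : ∀ n : ℕ, (∀ j, x j ≤ pclimb v n x j ∧ pclimb v n x j ≤ x j + n) ∧ pclimb v n x 2 = x 2 ∧
    hgt v x + n * κ ≤ hgt v (pclimb v n x) ∧ hgt v (pclimb v n x) ≤ hgt v x + n * K := by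
  obtain ⟨-, hκi, -, -⟩ := v_facts hv2 hκ hv0 hv1
  intro n
  induction n with
  | zero => simp
  | succ n ih =>
    obtain ⟨h1, h2, h3, h4⟩ := ih
    obtain ⟨hl2, -⟩ := plowIdx_low hv2 hκ hv0 hv1 (pclimb v n x)
    rw [pclimb_succ, hgt_step]
    have hκl := hκi _ hl2; have hKl := hvK (plowIdx v (pclimb v n x))
    refine ⟨fun j => ?_, ?_, by push_cast; linarith, by push_cast; linarith⟩
    · rw [DiagCone.step_apply]
      obtain ⟨a1, a2⟩ := h1 j
      by_cases hj : j = plowIdx v (pclimb v n x)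
      · rw [if_pos hj]; push_cast; constructor <;> omega
      · rw [if_neg hj]; push_cast; constructor <;> omega
    · rw [DiagCone.step_apply, if_neg (Ne.symm hl2), add_zero, h2]

include hv2 hκ hv0 hv1 hvK hτ hh hCD in
/-- **The positive climb stays in the cone.** [folklore] -/
theorem pclimb_mem {x : Site 3} (hx : x ∈ D) : ∀ n, pclimb v n x ∈ D := by
  intro n
  induction n with
  | zero => exact hx
  | succ n ih =>
    rw [pclimb_succ]
    exact step_mem₀ hv2 hκ hv0 hv1 hvK hτ hh hCD ih _ (plowIdx_low hv2 hκ hv0 hv1 _).2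

include hv2 hκ hv0 hv1 hvK hτ hh hCD in
/-- **THE SLACK CREATED BY THE POSITIVE CLIMB**: after `m` steps every pair inequality holds with slack `mτκ` — `D_{ij}(y) + mτκ ≤ τH(y)`,
`y = pclimb m x` (growing terms were `≤ 0` and become `≤ K ≤ τh`, the terms with the zero-weight coordinate are unchanged, `τH` grows by `≥ τκ`
per step). [folklore] -/
theorem pclimb_slack {x : Site 3} (hx : x ∈ D) :
    ∀ m : ℕ, ∀ i j : Fin 3, dev v (pclimb v m x) i j + m * (τ * κ) ≤ τ * hgt v (pclimb v m x) := by
  obtain ⟨hs, hd⟩ := (hCD x).1 hx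
  obtain ⟨hvn, hκi, -, -⟩ := v_facts hv2 hκ hv0 hv1
  have h0 := (consts₀ hv2 hκ hv0 hv1 hvK hτ hh).2.1
  have hKH : K ≤ τ * hgt v x := hh.trans (mul_le_mul_of_nonneg_left hs hτ.le)
  intro m
  induction m with
  | zero => intro i j; simpa using hd i j
  | succ m ih =>
    intro i j
    set y := pclimb v m x with hy
    set l := plowIdx v y with hl
    obtain ⟨hl2, hlow⟩ := plowIdx_low hv2 hκ hv0 hv1 y
    rw [← hl] at hl2 hlow
    have hgrow := (pclimb_props hv2 hκ hv0 hv1 hvK x (m + 1)).2.2.1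
    rw [pclimb_succ, ← hy, ← hl] at hgrow ⊢
    rw [hgt_step] at hgrow ⊢
    rw [dev_step]
    have hvl := hκi l hl2
    have hτκ : 0 ≤ τ * κ := mul_nonneg hτ.le hκ.le
    have hτy : τ * (hgt v x + ((m + 1 : ℕ) : ℝ) * κ) ≤ τ * (hgt v y + v l) := mul_le_mul_of_nonneg_left hgrow hτ.le
    push_cast at hτy ⊢
    have hτx : 0 ≤ τ * hgt v x := mul_nonneg hτ.le (h0.le.trans hs)
    have hτv : τ * κ ≤ τ * v l := mul_le_mul_of_nonneg_left hvl hτ.le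
    have hij := ih i j
    by_cases hi : i = l
    · by_cases hj : j = l
      · rw [if_pos hi, if_pos hj, hi, hj, dev_self]; linarith
      · rw [if_pos hi, if_neg hj]
        by_cases hj2 : j = 2
        · -- the zero-weight coordinate: `D_{l2}` grows by `v₂ = 0`
          rw [hj2] at hij ⊢
          rw [hv2]
          linarith
        · have hlj := hlow j hj2
          have hKj := hvK j
          rw [hi]
          linarith
    · rw [if_neg hi]
      by_cases hj : j = l
      · rw [if_pos hj]; have := hvn i; linarith
      · rw [if_neg hj]; linarith

/-! ## §2 Coordinate bounds, the box, the exits -/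

include hv2 hκ hv0 hv1 hCD in
/-- **Coordinates follow the ray**: `|⟨v,v⟩xⱼ − vⱼH(x)| ≤ τH(x)(v₀+v₁+v₂)` for every `j` (including the zero-weight coordinate: `⟨v,v⟩|x₂| ≤ τHS`).
[folklore] -/
theorem coord_bounds₀ {x : Site 3} (hx : x ∈ D) (j : Fin 3) :
    |(v 0 * v 0 + v 1 * v 1 + v 2 * v 2) * (x j : ℝ) - v j * hgt v x| ≤ τ * hgt v x * (v 0 + v 1 + v 2) := by
  rw [abs_le]
  obtain ⟨-, hd⟩ := (hCD x).1 hx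
  obtain ⟨hvn, -, -, -⟩ := v_facts hv2 hκ hv0 hv1
  have a0 := mul_le_mul_of_nonneg_left (hd j 0) (hvn 0)
  have a1 := mul_le_mul_of_nonneg_left (hd j 1) (hvn 1)
  have a2 := mul_le_mul_of_nonneg_left (hd j 2) (hvn 2)
  have b0 := mul_le_mul_of_nonneg_left (hd 0 j) (hvn 0)
  have b1 := mul_le_mul_of_nonneg_left (hd 1 j) (hvn 1)
  have b2 := mul_le_mul_of_nonneg_left (hd 2 j) (hvn 2)
  simp only [dev, hgt] at a0 a1 a2 b0 b1 b2 ⊢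
  constructor <;> linarith

include hv2 hκ hv0 hv1 hvK hτ hh hCD in
/-- **The boxes of the cut sets** (`B_N = N + ⌈C(N+K)⌉`, `C = (K + τS)/⟨v,v⟩` as in `WeightedConeExits`): `B` is monotone with `N ≤ B_N`, and every
cone point of height `≤ N + K` lies in `[-B_N, B_N]³` (`⟨v,v⟩|xⱼ| ≤ vⱼH + τHS ≤ (K + τS)(N + K)`). [cite: AizenmanChayesChayesFrohlichRusso1983, §4 (4.26)] -/
theorem box_facts₀ : (Monotone (WCone.boxR v τ K) ∧ ∀ N, N ≤ WCone.boxR v τ K N) ∧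
    ∀ (N : ℕ) (x : Site 3), x ∈ D → hgt v x ≤ (N : ℝ) + K → x ∈ boxSet 3 (WCone.boxR v τ K N) := by
  obtain ⟨hK, h0, hV⟩ := consts₀ hv2 hκ hv0 hv1 hvK hτ hh
  obtain ⟨hvn, -, -, -⟩ := v_facts hv2 hκ hv0 hv1
  have hsum : 0 ≤ v 0 + v 1 + v 2 := by have := hvn 0; have := hvn 1; have := hvn 2; positivity
  have hC : 0 ≤ bnd v τ K := by unfold bnd; positivity
  refine ⟨⟨fun N N' hNN => ?_, fun N => Nat.le_add_right _ _⟩, fun N x hx hs => ?_⟩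
  · unfold WCone.boxR
    have : bnd v τ K * ((N : ℝ) + K) ≤ bnd v τ K * ((N' : ℝ) + K) :=
      mul_le_mul_of_nonneg_left (by have h1 : (N : ℝ) ≤ N' := Nat.cast_le.2 hNN; linarith) hC
    exact Nat.add_le_add hNN (Nat.ceil_mono this)
  · -- `|xⱼ| ≤ C (N + K)`
    have hH : 0 < hgt v x := h0.trans_le ((hCD x).1 hx).1
    set S : ℝ := (N : ℝ) + K with hSdef
    set V := v 0 * v 0 + v 1 * v 1 + v 2 * v 2 with hVdef
    have habs : ∀ j, |(x j : ℝ)| ≤ bnd v τ K * S := by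
      intro j
      obtain ⟨h1, h2⟩ := abs_le.1 (coord_bounds₀ hv2 hκ hv0 hv1 hCD hx j)
      have hvj := hvK j; have hvj0 := hvn j
      have e1 : v j * hgt v x ≤ K * S := mul_le_mul hvj hs hH.le (hvj0.trans hvj)
      have e2 : τ * hgt v x * (v 0 + v 1 + v 2) ≤ τ * S * (v 0 + v 1 + v 2) :=
        mul_le_mul_of_nonneg_right (mul_le_mul_of_nonneg_left hs hτ.le) hsum
      have hup : V * (x j : ℝ) ≤ (K + τ * (v 0 + v 1 + v 2)) * S := by nlinarith
      have hlo : -((K + τ * (v 0 + v 1 + v 2)) * S) ≤ V * (x j : ℝ) := by nlinarith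
      have hCS : bnd v τ K * S = (K + τ * (v 0 + v 1 + v 2)) * S / V := by unfold bnd; rw [hVdef]; ring
      rw [hCS, abs_le]
      constructor
      · rw [neg_le, le_div_iff₀ hV]; linarith
      · rw [le_div_iff₀ hV]; linarith
    rw [mem_boxSet_iff]
    intro j
    have h1 := habs j
    have h2 : bnd v τ K * S ≤ (⌈bnd v τ K * S⌉₊ : ℝ) := Nat.le_ceil _
    have h3 : |(x j : ℝ)| ≤ ((WCone.boxR v τ K N : ℕ) : ℝ) := by
      unfold WCone.boxR; rw [← hSdef]; push_cast; linarith [abs_nonneg ((x j : ℝ))]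
    have h4 : ((|x j| : ℤ) : ℝ) ≤ (((WCone.boxR v τ K N : ℕ) : ℤ) : ℝ) := by push_cast; exact h3
    exact abs_le.1 (by exact_mod_cast h4)

include hv2 hκ hv0 hv1 hvK hτ hh hCD in
/-- **Exits of a cut set**: a point `u` of `Λ_N` with a `𝕂`-neighbour outside `Λ_N` has height `≤ N`, lies in `𝕂`, and has a cone neighbour `u + eⱼ`
of height `> N`. [cite: AizenmanChayesChayesFrohlichRusso1983, §4 (4.26)] -/
theorem exit_of_cut₀ {N : ℕ} {u : Site 3} (hu : u ∈ cut v (WCone.boxR v τ K) N)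
    (hw : ∃ w, w ∉ cut v (WCone.boxR v τ K) N ∧ (withinGraph (zdGraph 3) D).Adj u w) :
    hgt v u ≤ N ∧ u ∈ D ∧ ∃ j : Fin 3, u + Pi.single j 1 ∈ D ∧ (N : ℝ) < hgt v (u + Pi.single j 1) := by
  obtain ⟨w, hwΛ, hadj⟩ := hw
  rw [withinGraph_adj] at hadj
  obtain ⟨hzd, huD, hwD⟩ := hadj
  obtain ⟨hvn, -, -, -⟩ := v_facts hv2 hκ hv0 hv1
  obtain ⟨hK, -, -⟩ := consts₀ hv2 hκ hv0 hv1 hvK hτ hh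
  have hbox := (box_facts₀ hv2 hκ hv0 hv1 hvK hτ hh hCD).2 N
  have hu1 : hgt v u ≤ N := hu.1
  obtain ⟨j, hj | hj⟩ := (zdGraph_adj_iff u w).1 hzd
  · have hws : hgt v w = hgt v u + v j := by rw [hj, hgt_step]
    have hwbox : w ∈ boxSet 3 (WCone.boxR v τ K N) := hbox w hwD (by rw [hws]; have := hvK j; linarith)
    have hwgt : ¬ (hgt v w ≤ N) := fun hle => hwΛ ⟨hle, hwbox⟩
    refine ⟨hu1, huD, j, hj ▸ hwD, ?_⟩
    rw [← hj]; exact not_le.1 hwgt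
  · exfalso
    have hws : hgt v u = hgt v w + v j := by rw [hj, hgt_step]
    have hvj := hvn j
    have hwbox : w ∈ boxSet 3 (WCone.boxR v τ K N) := hbox w hwD (by linarith)
    exact hwΛ ⟨by linarith, hwbox⟩

/-! ## §3 The escape-and-climb datum -/

include hv2 hκ hv0 hv1 hvK hτ hh hCD in
/-- **The escape-and-climb datum**: if `u ∈ 𝕂`, `w = u + eⱼ ∈ 𝕂` with `H(w) > N`, `Λ ⊆ {H ≤ N}` and `|uᵢ| + n + 1 ≤ M`, then `n + 1` extra open edges of
`[-M, M]³` join `u` to `pclimb n w` through open exterior steps of `Λ` inside `𝕂`, with probability one. [cite: AizenmanChayesChayesFrohlichRusso1983, §4 Lemma 4.2 (a)] -/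
theorem escape_pclimb_datum {N : ℕ} {Λ : Set (Site 3)} (hΛ : ∀ y ∈ Λ, hgt v y ≤ (N : ℝ)) {M : ℕ} (p' : unitInterval) {u : Site 3}
    (hu : u ∈ D) {j : Fin 3} (hw : u + Pi.single j 1 ∈ D) (hwN : (N : ℝ) < hgt v (u + Pi.single j 1)) :
    ∀ n : ℕ, (∀ i, |u i| + ((n : ℤ) + 1) ≤ (M : ℤ)) → Datum D Λ p' M 1 (n + 1) u (pclimb v n (u + Pi.single j 1)) := by
  set w := u + Pi.single j 1 with hw_def
  have hbd : ∀ n m : ℕ, (∀ i, |u i| + ((n : ℤ) + 1) ≤ (M : ℤ)) → m ≤ n → ∀ i, |pclimb v m w i| ≤ (M : ℤ) := by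
    intro n m hM hm i
    obtain ⟨a1, a2⟩ := (pclimb_props hv2 hκ hv0 hv1 hvK w m).1 i
    have h1 := hM i
    have hwi : w i = u i + if i = j then 1 else 0 := by rw [hw_def, DiagCone.step_apply]
    have h2 := le_abs_self (u i); have h3 := neg_abs_le (u i)
    rw [abs_le]
    by_cases hij : i = j
    · rw [if_pos hij] at hwi; constructor <;> omega
    · rw [if_neg hij] at hwi; constructor <;> omega
  have hout : ∀ m, pclimb v m w ∉ Λ := fun m hmem => by
    have h1 := hΛ _ hmem
    have h2 := (pclimb_props hv2 hκ hv0 hv1 hvK w m).2.2.1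
    have h3 : (0 : ℝ) ≤ (m : ℝ) * κ := by positivity
    linarith
  intro n
  induction n with
  | zero =>
    intro hM
    have huM : ∀ i, |u i| ≤ (M : ℤ) := fun i => by have := hM i; push_cast at this; omega
    have h := step_datum (D := D) (Λ := Λ) (M := M) p' ((zdGraph_adj_iff u w).2 ⟨j, Or.inl rfl⟩) hu hw
      (fun h => hout 0 (by simpa using h.2)) huM (hbd 0 0 hM le_rfl)
    simpa [Datum] using h
  | succ n ih =>
    intro hM
    have h₁ := ih (fun i => by have := hM i; push_cast at this ⊢; omega)
    have h₂ := step_datum (D := D) (Λ := Λ) (M := M) p' (pclimb_adj v n w) (pclimb_mem hv2 hκ hv0 hv1 hvK hτ hh hCD hw n)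
      (pclimb_mem hv2 hκ hv0 hv1 hvK hτ hh hCD hw (n + 1)) (fun h => hout _ h.2) (hbd (n + 1) n hM (by omega))
      (hbd (n + 1) (n + 1) hM le_rfl)
    have h₃ := datum_chain zero_le_one h₁ h₂
    rw [one_mul] at h₃
    exact h₃

end Cone

end PWCone

end Summit.CriticalPhenomena.PercolationContinuityZ3.Theorems.Transplant

end
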